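import Summits.BirchSwinnertonDyer.BirchSwinnertonDyer.Theorems.GenusKolyvaginAtTwoShaCardDvdPowAtTwoRTSharpExponentRat
import Summits.BirchSwinnertonDyer.BirchSwinnertonDyer.Theorems.GenusKolyvaginAtTwoShaCardDvdPowAtTwoRTPerCellB2Q
import HarnessLib

/-!
# Route `GenusKolyvaginAtTwo`, crux U_T `ShaCardDvdPowAtTwoRT` (rev 39: stmt-BirchSwinnertonDyer-23469; lineage 23658), LINE 19 `rational_pair_descent` —
# (B2Q) OFF THE (D-NPh) CUT: Kolyvagin's Theorem B₂ at `l = 2` over `ℚ`, SHARP, with the odd multiplicative prime REPLACED by its only use,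
# the non-phantom hypothesis (NPh_K) «no non-zero everywhere-Selmer phantom class over `K` at any level `2^L`»

Seat `bsd-line-gk2-p4` g23 (WIDTH-5 attach, cell `bsd-f1-sign2`), `--supports stmt-BirchSwinnertonDyer-23469 --as helper`.
THEOREMS ONLY (no definition, no named fact, no `sorry`).  BSD is NOT proved by any of this; U_T is not touched (it is closed on the cut by
the LEAD's `…RTOnCut`); nothing is closed by this file.

WHY.  The route pen's per-cell B2Q instrument (`pub/ideators/bsd-idea-1/b2q/PERCELL-B2Q-g21.md` §6(ii)) and the residual crux
`AdditiveOnlyResidualAtTwoNegDisc` (stmt-BirchSwinnertonDyer-24826: Δ < 0, NO odd multiplicative prime) ask what (B2Q)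
`PlusDescent.two_pow_smul_selmer_rat_eq_zero_onHabitat` (gk2-p4 g22, p748779) costs off the (D-NPh) cut.  AUDIT of that proof: the binders
`(v) (h2v) (hNv) (hmult)` («an odd prime of multiplicative reduction») are used EXACTLY ONCE — to obtain, from gk2-p3's
`NonPhantomPow.nonPhantomAtTwo_of_hasMultiplicativeReductionAt` (p714902), the non-phantom property
  (NPh_K)  `∀ L ≥ 1, ∀ z ∈ H¹(K, E[2^L])`: `z|_{Γ(K(E[2^L]))} = 0` and `z` Selmer at every finite place of `K` ⟹ `z = 0`,
which feeds the separation hypothesis of gk2-p2's full-order pair Čebotarev theorem.  Everything else (the `τ`-sign of `c_M(1)`, `c_M(ℓ)`, the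
margin-one ℚ-descent at the transposition primes, McCallum 5.3 over `ℚ_ℓ`, the `K_λ ↔ ℚ_ℓ` transfers, the archimedean Selmer condition) uses
`Δ < 0`, the odd Tamagawa product, the 2-adic tower and the Heegner frame — but NEITHER the multiplicative prime NOR the second non-square
condition `¬ IsSquare (d_K·(−2|Δ|))` (binder `hsq2`, likewise consumed only by NPh; dropped here).  Hence:
* §1 `two_pow_smul_selmer_rat_eq_zero_of_nonPhantom_onHabitat` — (B2Q) with `(v) (h2v) (hNv) (hmult)` and `hsq2` replaced by the hypothesis (NPh_K)
  (binder `hNPh`, stated verbatim in the shape the proof consumes): **`2^{M₀} • s = 0` for every `s ∈ Sel_(2^M)(E/ℚ)`, every `M`**;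
* §2 `two_pow_M0_smul_eq_zero_of_mem_sha_rat_of_nonPhantom_onHabitat` — **`2^{M₀} · Ш(E/ℚ)[2^∞] = 0`** under the same hypotheses;
* §3 `natCard_primaryComponent_sha_rat_two_eq_sixteen_of_nonPhantom_onHabitat` — the route pen's PER-CELL SCHEMA (`…RTPerCellB2Q`, p751919)
  off the (D-NPh) cut: with `hndiv` at `2^3`, `#Ш(E/ℚ)[2] = 4` and `Ш[2] ⊆ 2·Ш[4]` force `#Ш(E/ℚ)[2^∞] = 16` (no finiteness input: §2 gives the
  exponent, `PerCellB2Q.natCard_eq_sixteen_of_exponent_four` the count).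
The landed (B2Q) is §1 ∘ `nonPhantomAtTwo_of_hasMultiplicativeReductionAt` (not restated here).  READING for 24826: on the additive-only
locus the ℚ-side sharp exponent survives wherever the Lawson–Wuthrich class is NOT an everywhere-Selmer phantom over `K` (seat-local 2-descent
of gk2-p5 g21: 848 of 858 additive-only instrument rows), i.e. the residual's genuinely engine-less part is the phantom rows only.
The proof of §1 is g22's proof VERBATIM with the one `have hNPh` deleted (adapted from `…RTSharpExponentRat.lean`).

References: [Kolyvagin1989Izv] Thm. B₂, §3; [McCallumLMS1991] §3 Cor. 3.2, §4 Prop. 4.4, Lemma 4.6, §5 Lemma 5.3; [GrossLMS1991] Props. 5.4, 6.2,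
8.2, §10; [LawsonWuthrich2016] §7.1 (the phantom class at `ℚ(E[4])`); [MilneADT2006] I Thm. 4.10, Cor. 3.4.
-/

set_option autoImplicit false
-- the Theorems namespace of this sub repeats the summit name by design (D-0017 nested layout)
set_option linter.dupNamespace false

noncomputable section

open scoped Classical
open scoped AddSubgroup

namespace Summit.BirchSwinnertonDyer.BirchSwinnertonDyer.Theorems.GenusExact.PlusDescent

open WeierstrassCurve NumberField IsDedekindDomain Field Rat.HeightOneSpectrum Literature.NumberTheory.EllipticCurves
  Literature.NumberTheory.GaloisRepresentations Literature.NumberTheory.EllipticCurves.ModularForms AddSubgroup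
  Literature.NumberTheory.EllipticCurves.RingClassField
open Summit.BirchSwinnertonDyer.BirchSwinnertonDyer.Theses.GenusKolyvaginAtTwo (KolyvaginRelationAtTwo)
open Summit.BirchSwinnertonDyer.Rank1Residual
open Summit.BirchSwinnertonDyer.BirchSwinnertonDyer.Theorems.GenusExact
open Summit.BirchSwinnertonDyer.BirchSwinnertonDyer.Theorems.GenusExact.VisiblePairAtTwo
  (kolPrime local_data liesOver_of_natCast_mem natCast_mem_primesEquiv_symm natCast_prime_mem_iff_eq hasGoodReductionAt_of_hasGoodReductionAtPrime
    not_mem_range)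

/-- **(B2Q) off the (D-NPh) cut — Kolyvagin's Theorem B₂ at `l = 2` over `ℚ`, SHARP, from the non-phantom hypothesis (NPh_K) in place
of the odd multiplicative prime**: on U_T's frame without `(v) (h2v) (hNv) (hmult)` and without `hsq2`, but with `hNPh`, `w(E) = +1`, modulo Q2:
`2^{M₀} • s = 0` for every `s ∈ Sel_(2^M)(E/ℚ)`, every `M`.  (Proof adapted verbatim from g22's `two_pow_smul_selmer_rat_eq_zero_onHabitat`.)
[cite: Kolyvagin1989Izv, Thm. B₂, §3] [cite: McCallumLMS1991, §3 Cor. 3.2, §4 Prop. 4.4, §5 Lemma 5.3] [cite: GrossLMS1991, §10, Props. 5.4, 6.2, 8.2]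
[cite: LawsonWuthrich2016, §7.1] -/
theorem two_pow_smul_selmer_rat_eq_zero_of_nonPhantom_onHabitat (hQ2 : KolyvaginRelationAtTwo)
    (W : WeierstrassCurve ℚ) [W.IsElliptic] [W.IsGloballyMinimal] [NeZero (W.conductorNorm ℤ)] (hcm : ¬ W.HasCM)
    (hT : Odd W.tamagawaProduct) (hneg : W.Δ < 0)
    (K : Type) [Field K] [NumberField K] (hIQ : IsImaginaryQuadratic K) (hodd : Odd (NumberField.discr K))
    (h3 : NumberField.discr K ≠ -3) (hHe : SatisfiesHeegnerHypothesis (W.conductorNorm ℤ) K)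
    (hsq1 : ¬ IsSquare ((NumberField.discr K : ℚ) * -|W.Δ|))
    (hρ : ∀ n : ℕ, 0 < n → W.HasSurjectiveModNGaloisRep ((2 : ℤ) ^ n))
    (hNPh : ∀ (L : ℕ), 1 ≤ L → ∀ z : galH1Torsion (W.baseChange K) ((2 ^ L : ℕ) : ℤ),
      (∀ ρ' ∈ torsionFixing (W.baseChange K) ((2 ^ L : ℕ) : ℤ), h1Eval (W.baseChange K) ((2 ^ L : ℕ) : ℤ) z ρ' = 0) →
      (∀ w : HeightOneSpectrum (𝓞 K), z ∈ selmerLocalKer (W.baseChange K) (w.adicCompletion K) ((2 ^ L : ℕ) : ℤ)) → z = 0)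
    (Dt : ModularParametrizationData W (W.conductorNorm ℤ)) (β : ℤ) (ι : K →+* ℂ) (d₁ : KolyvaginHeegnerData Dt β ι 1) (M₀ : ℕ)
    (hndiv : ¬ ∃ Q : (W.baseChange (ringClassField K ι 1)).toAffine.Point, ((2 ^ (M₀ + 1) : ℕ) : ℤ) • Q = d₁.derivedPoint)
    (hw1 : W.rootNumber = 1)
    (M : ℕ) (s₀ : galH1Torsion W ((2 ^ M : ℕ) : ℤ)) (hs₀ : s₀ ∈ selmerGroup W ((2 ^ M : ℕ) : ℤ)) :
    ((2 ^ M₀ : ℕ) : ℤ) • s₀ = 0 := by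
  haveI : Fact (Nat.Prime 2) := ⟨Nat.prime_two⟩
  haveI : ∀ j : ℕ, NumberField (ringClassField K ι j) := JET.numberField_ringClassField K hIQ ι
  haveI hell : (W.baseChange K).IsElliptic := inferInstanceAs ((W.map (algebraMap ℚ K)).IsElliptic)
  -- ### the trivial range `M ≤ M₀`
  by_cases hMM₀ : M ≤ M₀
  · obtain ⟨e, he⟩ := Nat.exists_eq_add_of_le hMM₀
    have h0 : ((2 ^ M : ℕ) : ℤ) • s₀ = 0 := zsmul_discreteH1_torsion _ s₀
    have hpow : ((2 ^ M₀ : ℕ) : ℤ) = ((2 ^ e : ℕ) : ℤ) * ((2 ^ M : ℕ) : ℤ) := by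
      rw [he, pow_add]; push_cast; ring
    rw [hpow, mul_smul, h0, zsmul_zero]
  have hM₀M : M₀ + 1 ≤ M := by omega
  have hM : 1 ≤ M := le_trans (Nat.le_add_left 1 M₀) hM₀M
  have hM' : 1 ≤ M + 1 := by omega
  -- ### numerics and currencies
  have hsurN : ∀ m : ℕ, W.HasSurjectiveModNGaloisRep ((2 ^ m : ℕ) : ℤ) :=
    MinimalTwinBSDTwo.forall_hasSurjectiveModNGaloisRep_two_pow_of_pos W hρ
  have hρN : ∀ m : ℕ, W.HasSurjectiveModNGaloisRep (2 ^ m : ℕ) := fun m ↦ by exact_mod_cast hsurN m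
  have hsurj1 : W.HasSurjectiveModNGaloisRep ((2 : ℤ) ^ 1) := hρ 1 one_pos
  have hs2 : W.HasSurjectiveModNGaloisRep 2 := by simpa using hsurj1
  have h2 : Module.finrank ℚ K = 2 := hIQ.1
  have hD4 : NumberField.discr K ≠ -4 := fun h ↦ by
    rw [h] at hodd; exact (Int.not_even_iff_odd.mpr hodd) ⟨-2, by norm_num⟩
  have hD : NumberField.discr K < -4 := X11b.KolyvaginAssembly.discr_lt_neg_four hIQ ⟨h3, hD4⟩
  -- the complex conjugation `τ = σ_θ`, `θ² = d_K`
  obtain ⟨θ, hθ, hd⟩ := Literature.NumberTheory.QuadraticFields.Quadratic.exists_not_mem_range_sq_eq_discr (K := K) h2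
  set τ : K ≃ₐ[ℚ] K := sigmaQ K h2 hθ hd with hτdef
  have hτ : τ ≠ 1 := sigmaQ_ne_one K h2 hθ hd
  -- ### no `2`-power torsion in `E(K)`
  have htorsK : ∀ (m : ℕ) (P : (W.baseChange K).toAffine.Point), ((2 ^ m : ℕ) : ℤ) • P = 0 → P = 0 := fun m P hP ↦
    EigenClassesFinite.forall_zsmul_two_pow_baseChange_eq_zero_of_hasSurjectiveModNGaloisRep_two W K h2 hs2 m P
      (by exact_mod_cast hP)
  -- ### the Selmer class over `K`: `s = res s₀`, `τ`-invariant, same order `2^a`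
  set s := resTorsion W K ((2 ^ M : ℕ) : ℤ) s₀ with hsdef
  have hsSel : s ∈ selmerGroup (W.baseChange K) ((2 ^ M : ℕ) : ℤ) := resTorsion_mem_selmerGroup W K ((2 ^ M : ℕ) : ℤ) hs₀
  have hinjres : Function.Injective (resTorsion W K ((2 ^ M : ℕ) : ℤ)) :=
    EigenClassesFinite.resTorsion_injective_of_noTorsion W K h2 hθ hd ((2 ^ M : ℕ) : ℤ) (htorsK M)
  have hτs : conjAct W τ ((2 ^ M : ℕ) : ℤ) s = s :=
    (EigenClassesFinite.mem_range_resTorsion_iff_conjAct_eq W K h2 hθ hd ((2 ^ M : ℕ) : ℤ) (htorsK M) s).mp ⟨s₀, rfl⟩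
  obtain ⟨a, haM, ha⟩ := exists_addOrderOf_galH1Torsion_eq_two_pow W K M s
  by_cases ha0 : a = 0
  · -- `s = 0`, hence `s₀ = 0`
    have hs0 : s = 0 := AddMonoid.addOrderOf_eq_one_iff.mp (by rw [ha, ha0, pow_zero])
    have : s₀ = 0 := hinjres (by rw [← hsdef, hs0, map_zero])
    rw [this, zsmul_zero]
  have ha1 : 1 ≤ a := Nat.one_le_iff_ne_zero.mpr ha0
  -- ### the Heegner class `y = c_M(1) = δ Ph`, order `2^κ`, `κ ≥ M − M₀`, sign `−1`
  have hdiv : ∀ P : geomPoints (W.baseChange K), ∃ Q : geomPoints (W.baseChange K), ((2 ^ M : ℕ) : ℤ) • Q = P :=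
    (W.baseChange K).zsmul_geomPoints_surjective_of_charZero (by positivity)
  set δ := kummerMapTorsion (W.baseChange K) ((2 ^ M : ℕ) : ℤ) hdiv with hδ
  have hker : δ.ker = (zsmulAddGroupHom (α := (W.baseChange K).toAffine.Point) ((2 ^ M : ℕ) : ℤ)).range := kummerMapTorsion_ker (W.baseChange K) ((2 ^ M : ℕ) : ℤ) hdiv
  obtain ⟨Ph, hPh, hPhmap⟩ := AdditiveKoly.exists_isHeegnerPoint_map_eq_derivedPoint_one (W := W) (K := K) (Dt := Dt) (β := β)
    (ι := ι) hIQ hHe d₁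
  set y := d₁.kolyvaginClass Nat.prime_two M with hydef
  have hc1 : y = δ Ph := VisiblePairAtTwo.kolyvaginClass_one_two_eq_kummerMapTorsion W K hIQ hodd hHe hsurj1 M d₁ Ph hPhmap
  have hP₀ : ∀ Q : (W.baseChange K).toAffine.Point, ((2 ^ (M₀ + 1) : ℕ) : ℤ) • Q ≠ Ph :=
    forall_two_pow_smul_ne_bottom_of_not_dvd_derivedPoint d₁ Ph hPhmap le_rfl hndiv
  obtain ⟨κ, hκM, hκ⟩ := exists_addOrderOf_galH1Torsion_eq_two_pow W K M y
  have hκge : M - M₀ ≤ κ := by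
    by_contra hlt'
    have h0 : ((2 ^ κ : ℕ) : ℤ) • y = 0 := (two_pow_zsmul_eq_zero_iff_of_addOrderOf W K hκ κ).mpr le_rfl
    have hmem : ((2 ^ κ : ℕ) : ℤ) • Ph ∈ δ.ker := by rw [AddMonoidHom.mem_ker, map_zsmul, ← hc1, h0]
    rw [hker] at hmem
    obtain ⟨R, hR⟩ := hmem
    have hPhR : Ph = ((2 ^ (M - κ) : ℕ) : ℤ) • R := eq_two_pow_zsmul_of_two_pow_zsmul_eq (htorsK 1 · <| by simpa using ·) hκM hR
    refine hP₀ (((2 ^ (M - κ - (M₀ + 1)) : ℕ) : ℤ) • R) ?_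
    rw [hPhR, smul_smul]
    congr 1
    push_cast
    rw [← pow_add]
    congr 1
    omega
  have hκ1 : 1 ≤ κ := by omega
  have h1K : ∀ q ∈ (1 : ℕ).primeFactors, Zhang2014.IsKolyvaginPrime (W.conductorNorm ℤ) W K 2 q ∧ M ≤ Zhang2014.kolyvaginIndex W 2 q := by
    simp
  have h1K' : ∀ q ∈ (1 : ℕ).primeFactors, Zhang2014.IsKolyvaginPrime (W.conductorNorm ℤ) W K 2 q ∧
      M + 1 ≤ Zhang2014.kolyvaginIndex W 2 q := by simp
  obtain ⟨-, hτy⟩ := KolyvaginClassSign.sign_conjAct_kolyvaginClass_two hIQ h3 hD4 hodd hHe hsurj1 τ hτ Dt β ι squarefree_one hM h1K d₁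
  rw [Nat.primeFactors_one, Finset.card_empty, pow_zero, mul_one, hw1] at hτy
  -- ### ONE LEVEL UP: `ι_* s`, `ι_* y` at level `2^(M+1)`
  have hdvd : ((2 ^ M : ℕ) : ℤ) ∣ ((2 ^ (M + 1) : ℕ) : ℤ) := KolyvaginPairDataTwo.two_pow_dvd_two_pow_succ M
  set ιM := torsionH1OfDvd (W.baseChange K) hdvd with hιM
  have hιinj : Function.Injective ιM := KolyvaginPairDataTwo.torsionH1OfDvd_succ_injective W M hIQ hs2
  have hsSel' : ιM s ∈ selmerGroup (W.baseChange K) ((2 ^ (M + 1) : ℕ) : ℤ) := torsionH1OfDvd_mem_selmerGroup (W.baseChange K) hdvd hsSel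
  have hySel : y ∈ selmerGroup (W.baseChange K) ((2 ^ M : ℕ) : ℤ) := by
    rw [hc1]; exact WeierstrassCurve.kummerMapTorsion_mem_selmerGroup (W.baseChange K) _ hdiv Ph
  have hySel' : ιM y ∈ selmerGroup (W.baseChange K) ((2 ^ (M + 1) : ℕ) : ℤ) := torsionH1OfDvd_mem_selmerGroup (W.baseChange K) hdvd hySel
  have hords' : addOrderOf (ιM s) = 2 ^ a := by rw [addOrderOf_injective ιM hιinj, ha]
  have hordy' : addOrderOf (ιM y) = 2 ^ κ := by rw [addOrderOf_injective ιM hιinj, hκ]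
  have hτs' : conjAct W τ ((2 ^ (M + 1) : ℕ) : ℤ) (ιM s) = (1 : ℤ) • ιM s := by
    rw [one_zsmul, hιM, conjAct_torsionH1OfDvd W τ hdvd s, hτs]
  have hτy' : conjAct W τ ((2 ^ (M + 1) : ℕ) : ℤ) (ιM y) = (-1 : ℤ) • ιM y := by
    rw [hιM, conjAct_torsionH1OfDvd W τ hdvd y, hτy, map_zsmul]
  -- separation for the pair from (NPh_{M+1}): both classes are Selmer
  have hres : ∀ a' b' : ℤ, (∀ ρ' ∈ torsionFixing (W.baseChange K) ((2 ^ (M + 1) : ℕ) : ℤ), h1Eval (W.baseChange K) ((2 ^ (M + 1) : ℕ) : ℤ) (a' • ιM s + b' • ιM y) ρ' = 0) →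
      a' • ιM s + b' • ιM y = 0 := by
    intro a' b' hab
    have hmem : a' • ιM s + b' • ιM y ∈ selmerGroup (W.baseChange K) ((2 ^ (M + 1) : ℕ) : ℤ) :=
      add_mem (AddSubgroup.zsmul_mem _ hsSel' a') (AddSubgroup.zsmul_mem _ hySel' b')
    exact hNPh (M + 1) hM' _ hab (fun w ↦ (((W.baseChange K).mem_selmerGroup_iff _ _).mp hmem).1 w)
  -- ### the Kolyvagin prime (gk2-p2's full-order pair Čebotarev at level `2^(M+1)`)
  have hinf := infinite_kolyvaginPrime_localization_fullOrder_pair (W.conductorNorm ℤ) W hcm hneg K hIQ hsq1 hρN τ hτ (M + 1) hM'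
    (ιM s) (ιM y) ha1 hκ1 hords' hordy' (Or.inl rfl) (Or.inr rfl) hτs' hτy' hres
  obtain ⟨ℓ, hℓmem⟩ := hinf.nonempty
  obtain ⟨hF', hkolZ, hidx', hloc'⟩ := hℓmem
  obtain ⟨hℓp, hℓN, hℓdK, hℓ2, hℓprime, hidxpos⟩ := hkolZ
  haveI : Fact ℓ.Prime := ⟨hℓp⟩
  have hF : FrobEqFrobInfty W K (2 ^ M) ℓ := FrobEqFrobInfty.of_dvd (pow_dvd_pow 2 (Nat.le_succ M)) hF'
  have hF2 : FrobEqFrobInfty W K 2 ℓ := FrobEqFrobInfty.of_dvd (dvd_pow_self 2 (Nat.succ_ne_zero M)) hF'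
  -- Gross's form of the Kolyvagin prime and its place `λ`
  have hkolG : Literature.NumberTheory.EllipticCurves.IsKolyvaginPrime (W.conductorNorm ℤ) W K 2 ℓ :=
    ⟨hℓp, hℓN, hℓdK, hℓ2, hℓprime, hF2⟩
  have hkolZ : Zhang2014.IsKolyvaginPrime (W.conductorNorm ℤ) W K 2 ℓ := ⟨hℓp, hℓN, hℓdK, hℓ2, hℓprime, hidxpos⟩
  have hkol : kolPrime W K M ℓ := KolyvaginPairDataTwo.kolPrime_of_isKolyvaginPrime_of_frobEqFrobInfty_succ (W := W) (K := K) h2 hM hkolG hF'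
  set w : HeightOneSpectrum (𝓞 K) := hkolG.place with hwdef
  have hwℓ : (ℓ : 𝓞 K) ∈ w.asIdeal := hkolG.mem_place
  set vℓ : HeightOneSpectrum (𝓞 ℚ) := primesEquiv.symm ⟨ℓ, hℓp⟩ with hvℓdef
  obtain ⟨_, hℓv, h2vℓ, hqv, hdKv⟩ := local_data hkol
  haveI hLO : w.asIdeal.LiesOver vℓ.asIdeal := liesOver_of_natCast_mem hℓp hℓv hwℓ
  obtain ⟨_hℓ', _hℓ2', _hℓd', hgood, _hFq, _hF2', _hMi, hinert⟩ := id hkol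
  have hgoodv : W.HasGoodReductionAt vℓ := hasGoodReductionAt_of_hasGoodReductionAtPrime W hgood hℓv
  -- ### full local orders at `λ`, transferred back to level `2^M` (`Γ_{K_λ}` fixes `E[2^(M+1)]`)
  obtain ⟨hαs', hαy'⟩ := hloc' w hwℓ
  have htriv : ∀ (g : absoluteGaloisGroup (hkolG.place.adicCompletion K)) (Q : geomTorsion (W.baseChange K) ((2 ^ (M + 1) : ℕ) : ℤ)),
      resGal (K := K) (hkolG.place.adicCompletion K) g • Q = Q := fun g Q ↦
    absGaloisRestrict_smul_geomTorsion_eq_of_kolyvaginPrime_pow W hIQ hPh Nat.prime_two hkolG (M + 1) hF' g Q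
  have htrans : ∀ x : galH1Torsion (W.baseChange K) ((2 ^ M : ℕ) : ℤ), x ∈ (W.baseChange K).torsionLocalKer (w.adicCompletion K) ((2 ^ M : ℕ) : ℤ) ↔
      ιM x ∈ (W.baseChange K).torsionLocalKer (w.adicCompletion K) ((2 ^ (M + 1) : ℕ) : ℤ) := fun x ↦
    mem_torsionLocalKer_iff_torsionH1OfDvd_mem (W.baseChange K) (w.adicCompletion K) (pow_dvd_pow 2 (Nat.le_succ M))
      (pow_ne_zero _ two_ne_zero) (pow_ne_zero _ two_ne_zero) htriv x
  have hαs : ∀ j : ℕ, ((2 ^ j : ℕ) : ℤ) • s ∈ (W.baseChange K).torsionLocalKer (w.adicCompletion K) ((2 ^ M : ℕ) : ℤ) ↔ a ≤ j := fun j ↦ by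
    rw [htrans, map_zsmul]; exact hαs' j
  have hαy : ∀ j : ℕ, ((2 ^ j : ℕ) : ℤ) • y ∈ (W.baseChange K).torsionLocalKer (w.adicCompletion K) ((2 ^ M : ℕ) : ℤ) ↔ κ ≤ j := fun j ↦ by
    rw [htrans, map_zsmul]; exact hαy' j
  -- ### the datum at conductor `ℓ` compatible with `d₁`, its class `x = c_M(ℓ)` (sign `+1`) and Q2 at `λ`
  obtain ⟨dℓ, hdℓ⟩ := JET.exists_compatible_data_of_grossCM
    (phi_heegnerPointOfConductor_mem_range_map_ringClassField_holds (W.conductorNorm ℤ) W K) hIQ hD hHe 2 Dt β ι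
    squarefree_one (by simp) d₁
  have hℓ1 : ℓ ∉ (1 : ℕ).primeFactors := by simp
  obtain ⟨hσ', hS', hS'', hemb'⟩ := hdℓ ℓ hkolZ hℓ1
  set d' := dℓ ℓ hkolZ hℓ1 with hd'_def
  set x := d'.kolyvaginClass Nat.prime_two M with hx_def
  have hc' : Squarefree (1 * ℓ) := by rw [one_mul]; exact hℓp.squarefree
  have hℓn : ¬ ℓ ∣ 1 := fun h ↦ hℓp.one_lt.ne' (Nat.dvd_one.mp h)
  have hkM : ∀ q ∈ (1 * ℓ).primeFactors, Zhang2014.IsKolyvaginPrime (W.conductorNorm ℤ) W K 2 q ∧ M ≤ Zhang2014.kolyvaginIndex W 2 q := by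
    intro q hq
    rw [one_mul, hℓp.primeFactors, Finset.mem_singleton] at hq
    subst hq
    exact ⟨hkolZ, le_trans (Nat.le_succ M) hidx'⟩
  have hkM1 : ∀ q ∈ (1 * ℓ).primeFactors, Zhang2014.IsKolyvaginPrime (W.conductorNorm ℤ) W K 2 q ∧
      M + 1 ≤ Zhang2014.kolyvaginIndex W 2 q := by
    intro q hq
    rw [one_mul, hℓp.primeFactors, Finset.mem_singleton] at hq
    subst hq
    exact ⟨hkolZ, hidx'⟩
  have hcard : (1 * ℓ).primeFactors.card = 1 := by rw [one_mul, hℓp.primeFactors, Finset.card_singleton]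
  -- signs: `c_M(ℓ)`, `c_{M+1}(ℓ)` are `τ`-invariant (`−w·(−1) = +1`)
  obtain ⟨-, hx⟩ := KolyvaginClassSign.sign_conjAct_kolyvaginClass_two hIQ h3 hD4 hodd hHe hsurj1 τ hτ Dt β ι hc' hM hkM d'
  obtain ⟨-, hx1⟩ := KolyvaginClassSign.sign_conjAct_kolyvaginClass_two hIQ h3 hD4 hodd hHe hsurj1 τ hτ Dt β ι hc' hM' hkM1 d'
  rw [hcard, pow_one, hw1] at hx hx1
  norm_num at hx hx1
  -- Q2 at the own prime: Selmer threshold of `x` at `λ` = zero threshold `κ` of `y`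
  have hQ := hQ2 W hcm K hIQ h3 hD4 hHe hρN Dt β ι M hM 1 ℓ hc' hℓp hℓn hkM d₁ d' hσ' hS' hS'' hemb' w hwℓ
  have hβ : ∀ j : ℕ, ((2 ^ j : ℕ) : ℤ) • x ∈ selmerLocalKer (W.baseChange K) (w.adicCompletion K) ((2 ^ M : ℕ) : ℤ) ↔ κ ≤ j :=
    fun j ↦ (hQ j).1.trans (((hQ j).2).trans (hαy j))
  -- ### the ℚ-descent `u` of `x` (TQ-DEEP, margin one): Selmer at every finite `v' ≠ v_ℓ` and at `∞`
  obtain ⟨u, hu, -⟩ := EigenClassesFinite.existsUnique_resTorsion_eq_of_conjAct_eq W K h2 hθ hd ((2 ^ M : ℕ) : ℤ) (htorsK M) hx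
  have hufin : ∀ v' : HeightOneSpectrum (𝓞 ℚ), v' ≠ vℓ → u ∈ selmerLocalKer W (v'.adicCompletion ℚ) ((2 ^ M : ℕ) : ℤ) := by
    intro v' hv'
    have hv'' : ∀ w' : HeightOneSpectrum (𝓞 K), w'.asIdeal.LiesOver v'.asIdeal → ((1 * ℓ : ℕ) : 𝓞 K) ∉ w'.asIdeal := by
      intro w' hw' hmem
      rw [one_mul] at hmem
      have hvmem : (ℓ : 𝓞 ℚ) ∈ v'.asIdeal := by
        have h : algebraMap (𝓞 ℚ) (𝓞 K) (ℓ : 𝓞 ℚ) ∈ w'.asIdeal := by rwa [map_natCast]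
        rw [← Ideal.mem_comap, ← Ideal.under_def, ← Ideal.LiesOver.over (P := w'.asIdeal) (p := v'.asIdeal)] at h
        exact h
      exact hv' ((natCast_prime_mem_iff_eq hℓp v').mp hvmem)
    obtain ⟨u', hu', hsel⟩ := SelmerDescent.exists_descent_kolyvaginClass_two_mem_selmerLocalKer_of_margin W hsurN hT K hIQ h2 hθ hd h3
      hD4 hHe Dt β ι M hc' hkM1 d' (htorsK (M + 1)) hx1 hx v' hv''
    have huu : u' = u := hinjres (hu'.trans hu.symm)
    rw [← huu]
    exact hsel
  have huinf : ∀ w' : InfinitePlace ℚ, u ∈ selmerLocalKer W w'.Completion ((2 ^ M : ℕ) : ℤ) := fun w' ↦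
    ArchVanishing.mem_selmerLocalKer_infinitePlace_of_Δ_neg W w' hneg ((2 ^ M : ℕ) : ℤ) u
  -- the Selmer threshold of `u` at `v_ℓ` is `κ`: `2^(κ−1) • u` is NOT Selmer there
  have hudv : ((2 : ℤ) ^ (κ - 1)) • u ∉ selmerLocalKer W (vℓ.adicCompletion ℚ) ((2 ^ M : ℕ) : ℤ) := by
    intro hmem
    have h' : ((2 : ℤ) ^ (κ - 1)) • resTorsion W K ((2 ^ M : ℕ) : ℤ) u ∈ selmerLocalKer (W.baseChange K) (w.adicCompletion K) ((2 ^ M : ℕ) : ℤ) :=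
      (SelmerDescent.zsmul_mem_selmerLocalKer_iff_resTorsion W h2 (not_mem_range hθ) hd ((2 ^ M : ℕ) : ℤ) vℓ w hgoodv hqv h2vℓ hdKv u _).mp hmem
    rw [hu] at h'
    have h'' : ((2 ^ (κ - 1) : ℕ) : ℤ) • x ∈ selmerLocalKer (W.baseChange K) (w.adicCompletion K) ((2 ^ M : ℕ) : ℤ) := by exact_mod_cast h'
    have := (hβ (κ - 1)).mp h''
    omega
  -- ### McCallum 5.3 + 2.2 over `ℚ_ℓ` (no lost bit): `2^(M − κ) • s₀` vanishes at `v_ℓ`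
  have hdual := FrobeniusCriterion.lemma_5_3_rat_two W hneg hM (q := 2 ^ M) rfl hℓ2 hℓv hgood hF2 (le_trans (Nat.le_succ M) hidx') hs₀
    hufin huinf hudv
  have hexp : M - 1 - (κ - 1) = M - κ := by omega
  rw [hexp] at hdual
  -- transfer to `K_λ`
  have hdualK : ((2 : ℤ) ^ (M - κ)) • s ∈ (W.baseChange K).torsionLocalKer (w.adicCompletion K) ((2 ^ M : ℕ) : ℤ) := by
    have h := (SelmerDescent.zsmul_mem_torsionLocalKer_iff_resTorsion_of_notMem W hneg hM (q := 2 ^ M) rfl hℓp hℓ2 hℓv hgoodv h2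
      (not_mem_range hθ) hd hdKv hF w (hinert w hwℓ) s₀ ((2 : ℤ) ^ (M - κ))).mp hdual
    exact h
  have hdualK' : ((2 ^ (M - κ) : ℕ) : ℤ) • s ∈ (W.baseChange K).torsionLocalKer (w.adicCompletion K) ((2 ^ M : ℕ) : ℤ) := by exact_mod_cast hdualK
  -- ### conclusion: `a ≤ M − κ ≤ M₀`
  have haMκ : a ≤ M - κ := (hαs (M - κ)).mp hdualK'
  have haM₀ : a ≤ M₀ := by omega
  have hs0 : ((2 ^ M₀ : ℕ) : ℤ) • s = 0 := (two_pow_zsmul_eq_zero_iff_of_addOrderOf W K ha M₀).mpr haM₀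
  apply hinjres
  rw [map_zsmul, map_zero, ← hsdef, hs0]

/-- **Corollary: `2^{M₀} · Ш(E/ℚ)[2^∞] = 0` off the (D-NPh) cut** — on U_T's frame with (NPh_K) in place of the odd multiplicative prime and
`w(E) = +1`, every class of `Ш(E/ℚ)` killed by a power of `2` is killed by `2^{M₀}` (`Sel_(2^k)(E/ℚ) ↠ Ш(E/ℚ)[2^k]`, Silverman X.4.2(a) = tree
`map_torsionH1ToH1_selmerGroup_holds`, and §1).  (Proof adapted verbatim from g22's `two_pow_M0_smul_eq_zero_of_mem_sha_rat_onHabitat`.)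
[cite: Kolyvagin1989Izv, Thm. B₂] [cite: McCallumLMS1991, §1 Theorem] [cite: SilvermanAEC2009, Thm. X.4.2(a)] [cite: LawsonWuthrich2016, §7.1] -/
theorem two_pow_M0_smul_eq_zero_of_mem_sha_rat_of_nonPhantom_onHabitat (hQ2 : KolyvaginRelationAtTwo)
    (W : WeierstrassCurve ℚ) [W.IsElliptic] [W.IsGloballyMinimal] [NeZero (W.conductorNorm ℤ)] (hcm : ¬ W.HasCM)
    (hT : Odd W.tamagawaProduct) (hneg : W.Δ < 0)
    (K : Type) [Field K] [NumberField K] (hIQ : IsImaginaryQuadratic K) (hodd : Odd (NumberField.discr K))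
    (h3 : NumberField.discr K ≠ -3) (hHe : SatisfiesHeegnerHypothesis (W.conductorNorm ℤ) K)
    (hsq1 : ¬ IsSquare ((NumberField.discr K : ℚ) * -|W.Δ|))
    (hρ : ∀ n : ℕ, 0 < n → W.HasSurjectiveModNGaloisRep ((2 : ℤ) ^ n))
    (hNPh : ∀ (L : ℕ), 1 ≤ L → ∀ z : galH1Torsion (W.baseChange K) ((2 ^ L : ℕ) : ℤ),
      (∀ ρ' ∈ torsionFixing (W.baseChange K) ((2 ^ L : ℕ) : ℤ), h1Eval (W.baseChange K) ((2 ^ L : ℕ) : ℤ) z ρ' = 0) →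
      (∀ w : HeightOneSpectrum (𝓞 K), z ∈ selmerLocalKer (W.baseChange K) (w.adicCompletion K) ((2 ^ L : ℕ) : ℤ)) → z = 0)
    (Dt : ModularParametrizationData W (W.conductorNorm ℤ)) (β : ℤ) (ι : K →+* ℂ) (d₁ : KolyvaginHeegnerData Dt β ι 1) (M₀ : ℕ)
    (hndiv : ¬ ∃ Q : (W.baseChange (ringClassField K ι 1)).toAffine.Point, ((2 ^ (M₀ + 1) : ℕ) : ℤ) • Q = d₁.derivedPoint)
    (hw1 : W.rootNumber = 1)
    (k : ℕ) (a : W.galH1) (ha : a ∈ W.sha) (hka : ((2 ^ k : ℕ) : ℤ) • a = 0) :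
    ((2 ^ M₀ : ℕ) : ℤ) • a = 0 := by
  rcases Nat.eq_zero_or_pos k with rfl | hkpos
  · rw [pow_zero, Nat.cast_one, one_zsmul] at hka
    rw [hka, zsmul_zero]
  · have hn : ((2 ^ k : ℕ) : ℤ) ≠ 0 := by positivity
    have hmem : a ∈ W.sha ⊓ torsionBy W.galH1 ((2 ^ k : ℕ) : ℤ) :=
      AddSubgroup.mem_inf.mpr ⟨ha, by change ((2 ^ k : ℕ) : ℤ) • a = 0; exact hka⟩
    rw [← WeierstrassCurve.map_torsionH1ToH1_selmerGroup_holds W hn] at hmem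
    obtain ⟨x, hx, rfl⟩ := AddSubgroup.mem_map.mp hmem
    rw [← map_zsmul, two_pow_smul_selmer_rat_eq_zero_of_nonPhantom_onHabitat hQ2 W hcm hT hneg K hIQ hodd h3 hHe hsq1 hρ hNPh Dt β ι d₁
      M₀ hndiv hw1 k x hx, map_zero]


/-- **PER-CELL B2Q SCHEMA off the (D-NPh) cut** (the route pen's `PerCellB2Q.natCard_primaryComponent_sha_rat_two_eq_sixteen_onHabitat` with the odd
multiplicative prime and `hsq2` replaced by (NPh_K)): on the rational frame with `w(E) = +1`, `hndiv` at `M₀ = 2`, the two 2-descent data of a cell —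
`#Ш(E/ℚ)[2] = 4` and `Ш(E/ℚ)[2] ⊆ 2·Ш(E/ℚ)[4]` — force **`#Ш(E/ℚ)[2^∞] = 16`** (modulo Q2).  No finiteness input is needed (§2 bounds the exponent;
the count is `PerCellB2Q.natCard_eq_sixteen_of_exponent_four`).  (Proof adapted from the pen's, p751919.)
[cite: Kolyvagin1989Izv, Thm. B₂] [cite: Cassels1962ArithmeticIV, Thm. 1.1] [cite: LawsonWuthrich2016, §7.1] -/
theorem natCard_primaryComponent_sha_rat_two_eq_sixteen_of_nonPhantom_onHabitat (hQ2 : KolyvaginRelationAtTwo)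
    (W : WeierstrassCurve ℚ) [W.IsElliptic] [W.IsGloballyMinimal] [NeZero (W.conductorNorm ℤ)] (hcm : ¬ W.HasCM)
    (hT : Odd W.tamagawaProduct) (hneg : W.Δ < 0)
    (K : Type) [Field K] [NumberField K] (hIQ : IsImaginaryQuadratic K) (hodd : Odd (NumberField.discr K))
    (h3 : NumberField.discr K ≠ -3) (hHe : SatisfiesHeegnerHypothesis (W.conductorNorm ℤ) K)
    (hsq1 : ¬ IsSquare ((NumberField.discr K : ℚ) * -|W.Δ|))
    (hρ : ∀ n : ℕ, 0 < n → W.HasSurjectiveModNGaloisRep ((2 : ℤ) ^ n))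
    (hNPh : ∀ (L : ℕ), 1 ≤ L → ∀ z : galH1Torsion (W.baseChange K) ((2 ^ L : ℕ) : ℤ),
      (∀ ρ' ∈ torsionFixing (W.baseChange K) ((2 ^ L : ℕ) : ℤ), h1Eval (W.baseChange K) ((2 ^ L : ℕ) : ℤ) z ρ' = 0) →
      (∀ w : HeightOneSpectrum (𝓞 K), z ∈ selmerLocalKer (W.baseChange K) (w.adicCompletion K) ((2 ^ L : ℕ) : ℤ)) → z = 0)
    (Dt : ModularParametrizationData W (W.conductorNorm ℤ)) (β : ℤ) (ι : K →+* ℂ) (d₁ : KolyvaginHeegnerData Dt β ι 1)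
    (hndiv : ¬ ∃ Q : (W.baseChange (ringClassField K ι 1)).toAffine.Point, ((2 ^ (2 + 1) : ℕ) : ℤ) • Q = d₁.derivedPoint)
    (hw1 : W.rootNumber = 1)
    (h2 : Nat.card {a : W.galH1 // a ∈ W.sha ∧ (2 : ℤ) • a = 0} = 4)
    (hdiv : ∀ a ∈ W.sha, (2 : ℤ) • a = 0 → ∃ b ∈ W.sha, (4 : ℤ) • b = 0 ∧ (2 : ℤ) • b = a) :
    Nat.card (AddCommGroup.primaryComponent W.sha 2) = 16 := by
  haveI : Fact (Nat.Prime 2) := ⟨Nat.prime_two⟩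
  set H : AddSubgroup W.sha := AddCommGroup.primaryComponent W.sha 2 with hH
  -- membership in `Ш[2^∞]` from a `2`-power annihilator
  have hmemH : ∀ (y : W.sha) (i : ℕ), (2 ^ i) • y = 0 → y ∈ H := fun y i hy ↦
    (AddCommGroup.mem_primaryComponent).2 ⟨i, hy⟩
  -- coercion bookkeeping `↥Ш → H¹`
  have hcoe : ∀ (y : W.sha) (n : ℤ), n • y = 0 ↔ n • (y : W.galH1) = 0 := by
    intro y n
    constructor
    · intro h
      have := congrArg (fun z : W.sha => (z : W.galH1)) h
      simpa only [AddSubgroupClass.coe_zsmul, ZeroMemClass.coe_zero] using this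
    · intro h
      apply Subtype.ext
      simpa only [AddSubgroupClass.coe_zsmul, ZeroMemClass.coe_zero] using h
  -- exponent `4` on `Ш[2^∞]` = §2 at `M₀ = 2`
  have h4 : ∀ x ∈ H, (4 : ℤ) • x = 0 := by
    intro x hx
    obtain ⟨j, hj⟩ := (AddCommGroup.mem_primaryComponent).1 hx
    have hxj : ((2 ^ j : ℕ) : ℤ) • (x : W.galH1) = 0 := by
      rw [← hcoe, natCast_zsmul]; exact hj
    have hB := two_pow_M0_smul_eq_zero_of_mem_sha_rat_of_nonPhantom_onHabitat hQ2 W hcm hT hneg K hIQ hodd h3 hHe hsq1 hρ hNPh Dt β ι d₁ 2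
      hndiv hw1 j (x : W.galH1) x.2 hxj
    have h22 : ((2 ^ 2 : ℕ) : ℤ) = 4 := by norm_num
    rw [h22] at hB
    exact (hcoe x 4).mpr hB
  -- `Ш[2] ⊆ 2 · Ш[4]` inside `Ш[2^∞]`
  have hdivH : ∀ x ∈ H, (2 : ℤ) • x = 0 → ∃ y ∈ H, (2 : ℤ) • y = x := by
    intro x hx h2x
    obtain ⟨b, hb, h4b, h2b⟩ := hdiv (x : W.galH1) x.2 ((hcoe x 2).mp h2x)
    have h4b' : (2 ^ 2) • (⟨b, hb⟩ : W.sha) = 0 := by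
      rw [← natCast_zsmul, hcoe]; norm_num; exact h4b
    refine ⟨⟨b, hb⟩, hmemH ⟨b, hb⟩ 2 h4b', ?_⟩
    apply Subtype.ext
    simpa only [AddSubgroupClass.coe_zsmul] using h2b
  -- `#Ш[2^∞][2] = #Ш[2] = 4`
  have h2H : Nat.card {x : W.sha // x ∈ H ∧ (2 : ℤ) • x = 0} = 4 := by
    rw [← h2]
    have h21 : ∀ (a : W.galH1) (ha : a ∈ W.sha), (2 : ℤ) • a = 0 → (2 ^ 1) • (⟨a, ha⟩ : W.sha) = 0 := by
      intro a ha h; rw [pow_one, ← natCast_zsmul, hcoe]; show ((2 : ℕ) : ℤ) • a = 0; exact_mod_cast h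
    refine Nat.card_congr ?_
    refine
      { toFun := fun x => ⟨(x.1 : W.galH1), ⟨x.1.2, (hcoe x.1 2).mp x.2.2⟩⟩
        invFun := fun a => ⟨⟨a.1, a.2.1⟩, ⟨hmemH ⟨a.1, a.2.1⟩ 1 (h21 a.1 a.2.1 a.2.2), (hcoe ⟨a.1, a.2.1⟩ 2).mpr a.2.2⟩⟩
        left_inv := fun x => by ext; rfl
        right_inv := fun a => by rfl }
  exact PerCellB2Q.natCard_eq_sixteen_of_exponent_four H h4 hdivH h2H

end Summit.BirchSwinnertonDyer.BirchSwinnertonDyer.Theorems.GenusExact.PlusDescent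

end
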